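/-
Copyright: public-domain mathematics; typed transcription for the H21 Literature library (cell lit-balaban,
reader/typer seat r02 gen 5 = literature-prover-lit-balaban-r02-g5-0).

statement-level skeleton of published theorems with citation tags; proofs where landed; nothing here is a claim about the Yang–Mills mass gap

# Bałaban, *Propagators and renormalization transformations for lattice gauge theories. I*,
# Commun. Math. Phys. **95** (1984) 17–40 — the SOURCE MAP ι of the (1.132) carrier on the three kinds:
# `LocR` (G side, product tori) → `LocT` (G₀ side, tower), and its `MapFacts` fields

[cite: Balaban1984PropagatorsI]  T. Bałaban, Commun. Math. Phys. 95 (1984) 17–40.  p. 39 (1.132); p. 35 (1.108) `|J|`, supp J ⊂ Δ̃(y′);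
p. 33 (1.89) `‖J‖` (weight η^d, (1.21) p. 21).

WHAT THIS MODULE ADDS (SKELETON row B5.Prop1.2 census (vii), (1.132) half; sequel of `B5Carrier132Maps`): `ιR : LocR n M → LocT P`
(kindwise `pullV`), `supp_ιR` (`supp_map`), `supNormT_ιR_le` (`supNorm_map`), and the weighted norms AGREE `l2NormT_ιR`
(`‖ι J‖ = ‖J‖`, both the printed `L²(T_η)` norm).

HONEST SCOPE.  Bookkeeping; nothing analytic.
-/
import Mathlib
import Literature.MathematicalPhysics.QuantumFieldTheory.Balaban1983to89.B5Carrier132Maps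
import Literature.MathematicalPhysics.QuantumFieldTheory.Balaban1983to89.B5TowerSourcesG0

open scoped BigOperators Matrix Real
open Finset Matrix

namespace Literature.MathematicalPhysics.QuantumFieldTheory.Balaban1983to89.B5Carrier132Maps

open Literature.MathematicalPhysics.QuantumFieldTheory.Balaban1983to89
open Literature.MathematicalPhysics.QuantumFieldTheory.Balaban1983to89.B5Prop11Plancherel (Tor fine)
open Literature.MathematicalPhysics.QuantumFieldTheory.Balaban1983to89.B5Prop11Lattice (l2 l2T)
open Literature.MathematicalPhysics.QuantumFieldTheory.Balaban1983to89.B5SiteBridgeP12 (nP MP eFine eUnit)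
open Literature.MathematicalPhysics.QuantumFieldTheory.Balaban1983to89.B5G0BridgeP12 (embA embA_apply l2NormV_eq nsq_embA)
open Literature.MathematicalPhysics.QuantumFieldTheory.Balaban1983to89.B5Prop12FieldsLattice (cubeT suppInL supNormL)
open Literature.MathematicalPhysics.QuantumFieldTheory.Balaban1983to89.B5SettingP12Real (LocR latticeSettingP12R)
open Literature.MathematicalPhysics.QuantumFieldTheory.Balaban1983to89.B5SettingP12Weighted (sqEta etaPow etaPow_nonneg)
open Literature.MathematicalPhysics.QuantumFieldTheory.Balaban1983to89.B5TowerSourcesG0 (LocT suppInT supNormT l2NormT l2Fam_eq_mul)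
open Literature.MathematicalPhysics.QuantumFieldTheory.Balaban1983to89.B5G0SettingTorus (l2Fam)
open Literature.MathematicalPhysics.QuantumFieldTheory.Balaban1983to89.B5GpSettingTorus (supNormV)
open Literature.MathematicalPhysics.QuantumFieldTheory.Balaban1983to89.LatticeNorms (supNorm supNorm_nonneg norm_le_supNorm)

noncomputable section

variable (P : Params)

/-! ## The source map ι on the three kinds and its `MapFacts` fields -/

/-- **ι: sources of the G side ↦ sources of the tower, kind by kind** (`pullV` on every component). [cite: Balaban1984PropagatorsI, (1.132) p.39] -/
def ιR : LocR (nP P) (MP P) → LocT P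
  | .vec J => .vec (pullV P J)
  | .ten T => .ten fun ν => pullV P (T ν)
  | .ten2 T => .ten2 fun p => pullV P (T p)

/-- **`supp_map`: `supp J ⊂ Δ̃(y′)` is preserved by ι, σ.** [cite: Balaban1984PropagatorsI, Prop. 1.2 p.35 (supp J ⊂ Δ̃(y′))] -/
theorem supp_ιR (a : ℝ) (J : LocR (nP P) (MP P)) (y' : Tor (MP P)) (hJ : (latticeSettingP12R (nP P) (MP P) a P.K).suppIn J y') :
    suppInT P P.K (ιR P J) (σR P y') := by
  cases J with
  | vec J => exact supp_pullV P J y' fun b hb => hJ b (by simpa [LocR.emb] using hb)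
  | ten T => exact fun ν => supp_pullV P (T ν) y' fun b hb => hJ ν b (by simpa [LocR.emb] using hb)
  | ten2 T => exact fun p => supp_pullV P (T p) y' fun b hb => hJ p b (by simpa [LocR.emb] using hb)

/-- **`supNorm_map`: `|ι J| ≤ |J|`.** [cite: Balaban1984PropagatorsI, (1.108) p.35] -/
theorem supNormT_ιR_le (J : LocR (nP P) (MP P)) : supNormT P (ιR P J) ≤ supNormL (nP P) (MP P) J.emb := by
  cases J with
  | vec J => exact supNormV_pullV_le P J
  | ten T =>
      show Finset.univ.sup' ⟨⟨0, P.hd⟩, Finset.mem_univ _⟩ (fun ν => supNormV P (pullV P (T ν))) ≤ _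
      refine Finset.sup'_le _ _ fun ν _ => (supNormV_pullV_le P (T ν)).trans ?_
      refine LatticeNorms.supNorm_le (supNorm_nonneg _ _) fun b _ => ?_
      exact norm_le_supNorm (fun p : Fin P.d × (Tor (fine (nP P) (MP P)) × Fin P.d) => ((T p.1 p.2 : ℝ) : ℂ))
        (Finset.mem_univ (ν, b))
  | ten2 T =>
      show Finset.univ.sup' ⟨(⟨0, P.hd⟩, ⟨0, P.hd⟩), Finset.mem_univ _⟩ (fun p => supNormV P (pullV P (T p))) ≤ _
      refine Finset.sup'_le _ _ fun p _ => (supNormV_pullV_le P (T p)).trans ?_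
      refine LatticeNorms.supNorm_le (supNorm_nonneg _ _) fun b _ => ?_
      exact norm_le_supNorm (fun q : (Fin P.d × Fin P.d) × (Tor (fine (nP P) (MP P)) × Fin P.d) => ((T q.1 q.2 : ℝ) : ℂ))
        (Finset.mem_univ (p, b))

/-- the weighted norm of a pulled family equals `η^{d/2}·ℓ²` of the bond function. [cite: Balaban1984PropagatorsI, (1.89) p.33, (1.21) p.21] -/
theorem l2Fam_pullV (F : Tor (fine (nP P) (MP P)) × Fin P.d → ℝ) :
    l2Fam P P.K (pullV P F) = sqEta (nP P) P.d * l2 (fun b => (F b : ℂ)) := by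
  rw [← B5G0SettingTorus.l2NormV_eq_l2Fam, l2NormV_eq, embA_pullV]

/-- **`‖ι J‖ = ‖J‖`** (both the printed weighted norm). [cite: Balaban1984PropagatorsI, (1.89) p.33, (1.21) p.21] -/
theorem l2NormT_ιR (a : ℝ) (J : LocR (nP P) (MP P)) :
    l2NormT P P.K (ιR P J) = (latticeSettingP12R (nP P) (MP P) a P.K).l2Norm J := by
  cases J with
  | vec J => exact l2Fam_pullV P J
  | ten T =>
      show l2Fam P P.K (fun p : Fin P.d × Fin P.d => pullV P (T p.1) p.2) = sqEta (nP P) P.d * l2T (fun ν b => ((T ν b : ℝ) : ℂ))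
      rw [l2Fam_eq_mul, sqEta, B5G0BridgeP12.Lpow_inv_pow_d, l2T, Fintype.sum_prod_type]
      congr 1
      congr 1
      refine Finset.sum_congr rfl fun ν _ => ?_
      rw [← nsq_embA P (pullV P (T ν)), embA_pullV]
  | ten2 T =>
      show l2Fam P P.K (fun p : (Fin P.d × Fin P.d) × Fin P.d => pullV P (T p.1) p.2)
        = sqEta (nP P) P.d * l2T (fun q b => ((T q b : ℝ) : ℂ))
      rw [l2Fam_eq_mul, sqEta, B5G0BridgeP12.Lpow_inv_pow_d, l2T, Fintype.sum_prod_type]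
      congr 1
      congr 1
      refine Finset.sum_congr rfl fun q _ => ?_
      rw [← nsq_embA P (pullV P (T q)), embA_pullV]

end

end Literature.MathematicalPhysics.QuantumFieldTheory.Balaban1983to89.B5Carrier132Maps
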